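import Summits.MatrixMultiplication.OmegaCensus.SmallFormats.MatMul22nLShapeKill
import Summits.MatrixMultiplication.OmegaCensus.SmallFormats.MatMul22nF3LineLemmas
import HarnessLib

/-!
# ω-census family (a): an ADMISSIBLE (row pair, column pair) kills an L-shape — the glue between the κ/λ-line structures and the L-shape deflation (`𝔽₃`)

Cell `pub-omega` (unit `pub-omega-tensor`, gen 40), topic `Summits/MatrixMultiplication/OmegaCensus` (sub-folder
`SmallFormats`). Framing (verbatim): lottery ticket; floor = certified bounds/negative ranges. HONEST FRAMING: M1-LEAN-BLUEPRINT F3a (memo DEFLATION-g40 §3).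
Inputs: the line structure of a row `v` (`AllOnesRowTypes.row_structure`: cheap vectors `c`, terms `t j` by column, line map `L`, null-line facts, shapes) and
of a column `μ` (`AllOnesColTypes.col_structure`: `b μ`, terms `s i` by row, line map `L'`), a coincident pair `L a = L bb` of the row with `μ` outside it and
`L μ ≠ L a`, a coincident pair `L' a' = L' bb'` of the column with `L' v ≠ L' a'` (so `v` is outside it). Output (`AdmissiblePairKill.exists_deflation`): the
kill vector `c⋆ = ∑ rep(L a)_l • c l` and kill covector `n⋆ = ∑ rep(L' a')_l • b μ l` are admissible (`n⋆ · c⋆ ≠ 0`, by `LShapeKill.pairing_ne_zero_of_lines`),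
so `LShapeKill.exists_deflation` removes the L-shape `{t μ, t j₄, s v₄}` (`j₄`, `v₄` = the remaining column / row). Nothing here is a bound on `ω`.
-/

namespace Summit.MatrixMultiplication.OmegaCensus.SmallFormats

open Finset Module Matrix
open Literature.Computability.AlgebraicComplexity

namespace AdmissiblePairKill

variable {n : ℕ} {ι : Type*} [Fintype ι]

/-- Distinct representatives are not parallel. -/
theorem cross_rep_rep_ne_zero (i j : Fin 4) (hij : i ≠ j) :
    (![![1, 0], ![0, 1], ![1, 1], ![1, 2]] : Fin 4 → Fin 2 → ZMod 3) i 0 * (![![1, 0], ![0, 1], ![1, 1], ![1, 2]] : Fin 4 → Fin 2 → ZMod 3) j 1 - (![![1, 0], ![0, 1], ![1, 1], ![1, 2]] : Fin 4 → Fin 2 → ZMod 3) i 1 * (![![1, 0], ![0, 1], ![1, 1], ![1, 2]] : Fin 4 → Fin 2 → ZMod 3) j 0 ≠ 0 := by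
  revert i j; decide

/-- Representatives are non-zero. -/
theorem rep_ne_zero (i : Fin 4) : (![![1, 0], ![0, 1], ![1, 1], ![1, 2]] : Fin 4 → Fin 2 → ZMod 3) i ≠ 0 := by
  revert i; decide

/-- **Admissible pair ⇒ L-shape kill.** -/
theorem exists_deflation [DecidableEq ι] (β : BilinComp (mulBilin (ZMod 3) 2 2 (n + 1)) ι) (v μ : Fin 4)
    (c : Fin 2 → (Fin (n + 1) → ZMod 3)) (bμ : Fin 2 → (Fin (n + 1) → ZMod 3)) (t s : Fin 4 → ι) (L L' : Fin 4 → Fin 4)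
    -- row v against column μ: null line of the Gram block and its maximality
    (hL2 : ∀ x : Fin 2 → ZMod 3, (∀ m, (∑ l, x l • c l) ⬝ᵥ bμ m = 0) → x 0 * (![![1, 0], ![0, 1], ![1, 1], ![1, 2]] : Fin 4 → Fin 2 → ZMod 3) (L μ) 1 - x 1 * (![![1, 0], ![0, 1], ![1, 1], ![1, 2]] : Fin 4 → Fin 2 → ZMod 3) (L μ) 0 = 0)
    (hshape : ∀ a bb j, a ≠ bb → L a = L bb → j ≠ a → j ≠ bb →
      ∃ η : Fin 2 → ZMod 3, ∀ q : Fin 2, (fun jj => β.g (t j) (Matrix.single q jj (1 : ZMod 3))) = η q • ∑ l, (![![1, 0], ![0, 1], ![1, 1], ![1, 2]] : Fin 4 → Fin 2 → ZMod 3) (L a) l • c l)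
    -- column μ against row v
    (hL'1 : ∀ m, (∑ l, (![![1, 0], ![0, 1], ![1, 1], ![1, 2]] : Fin 4 → Fin 2 → ZMod 3) (L' v) l • bμ l) ⬝ᵥ c m = 0)
    (hshape' : ∀ a bb i, a ≠ bb → L' a = L' bb → i ≠ a → i ≠ bb →
      ∃ ω : Fin 2 → ZMod 3, ∀ q : Fin 2, β.w (s i) q = ω q • ∑ l, (![![1, 0], ![0, 1], ![1, 1], ![1, 2]] : Fin 4 → Fin 2 → ZMod 3) (L' a) l • bμ l)
    -- the two pairs
    (a bb j₄ : Fin 4) (hab : a ≠ bb) (hLab : L a = L bb) (hμa : μ ≠ a) (hμb : μ ≠ bb) (hLμ : L μ ≠ L a) (hj₄a : j₄ ≠ a) (hj₄b : j₄ ≠ bb)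
    (a' bb' v₄ : Fin 4) (hab' : a' ≠ bb') (hLab' : L' a' = L' bb') (hL'v : L' v ≠ L' a') (hv₄a : v₄ ≠ a') (hv₄b : v₄ ≠ bb') :
    ∃ (β' : BilinComp (mulBilin (ZMod 3) 2 2 n) (Fin (Fintype.card ι - ({t μ, t j₄, s v₄} : Finset ι).card)))
      (e : Fin (Fintype.card ι - ({t μ, t j₄, s v₄} : Finset ι).card) → ι),
      Function.Injective e ∧ (∀ x, e x ∉ ({t μ, t j₄, s v₄} : Finset ι)) ∧ ∀ x, β'.f x = β.f (e x) := by
  classical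
  set rep : Fin 4 → Fin 2 → ZMod 3 := (![![1, 0], ![0, 1], ![1, 1], ![1, 2]] : Fin 4 → Fin 2 → ZMod 3) with hrep
  set cstar : Fin (n + 1) → ZMod 3 := ∑ l, rep (L a) l • c l with hcstar
  set nstar : Fin (n + 1) → ZMod 3 := ∑ l, rep (L' a') l • bμ l with hnstar
  set P : Matrix (Fin 2) (Fin 2) (ZMod 3) := Matrix.of fun l m => c l ⬝ᵥ bμ m with hP
  -- admissibility
  have hx : Matrix.vecMul (rep (L a)) P ≠ 0 := by
    intro h0
    apply hLμ
    have hc : (rep (L a)) 0 * rep (L μ) 1 - (rep (L a)) 1 * rep (L μ) 0 = 0 := by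
      refine hL2 (rep (L a)) fun m => ?_
      rw [GramNondeg.combo_dotProduct_eq_vecMul, h0, Pi.zero_apply]
    by_contra hne
    exact cross_rep_rep_ne_zero (L a) (L μ) (Ne.symm hne) (by rw [hrep] at hc; exact hc)
  have hyv : Matrix.mulVec P (rep (L' v)) = 0 := by
    funext l
    rw [Pi.zero_apply, ← GramNondeg.dotProduct_combo_eq_mulVec, dotProduct_comm]
    exact hL'1 l
  have hny : rep (L' a') 0 * rep (L' v) 1 - rep (L' a') 1 * rep (L' v) 0 ≠ 0 :=
    cross_rep_rep_ne_zero (L' a') (L' v) (Ne.symm hL'v)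
  have hadm : nstar ⬝ᵥ cstar ≠ 0 := by
    rw [dotProduct_comm, hcstar, hnstar, LShapeKill.combo_dot_combo]
    exact LShapeKill.pairing_ne_zero_of_lines P (rep (L a)) (rep (L' a')) (rep (L' v)) hx hyv (rep_ne_zero (L' v)) hny
  -- the three shapes
  have h₁ := hshape a bb μ hab hLab hμa hμb
  have h₂ := hshape a bb j₄ hab hLab hj₄a hj₄b
  have hs := hshape' a' bb' v₄ hab' hLab' hv₄a hv₄b
  exact LShapeKill.exists_deflation β cstar nstar hadm (t μ) (t j₄) (s v₄) h₁ h₂ hs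

end AdmissiblePairKill

end Summit.MatrixMultiplication.OmegaCensus.SmallFormats
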